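import Summits.ABC.IUTFork.Cor312ThetaFinitePrVolMSharp
import Summits.ABC.IUTFork.Cor312ThetaSideGenuineM
import Summits.ABC.IUTFork.Cor312PilotIdelesPrThetaSide
import HarnessLib

/-!
# [IUTchIII] Corollary 3.12 at the M-LEVEL summand-route sharp setting over the genuine carriers `K_{v̲}` — the Θ-SIDE NUMBERS:
# every Kummer image of the Θ-pilot object has global volume `−deĝ(P_{Θ,j})`, hence `−deĝ_lgp(P_Θ) ≤ −|log(Θ)|`
# (G1-Θ unit P5c of `HOME/staging/w5/w5-d166/g4/G1-THETA-SHAPES.md`, C-lead ruling C-R12 (e) «target #2′»)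

PROOF-ONLY record file (D-0012; no definitions, no `Prop` facts) of the abc-iut cell (R2 S-chain seat abc-iut-s2-p9, gen 0;
branch C «abc ⇐ S»). TAKES NO SIDE on [IUTchIII] Cor. 3.12. The M-level twin of abc-iut-c312-7's `Cor312PilotIdelesPrThetaSide`
(p426498, §1–§3) at abc-iut-w4-d013's summand-route setting `settingPrVolM` (p435693) AT THE SHARP BINDERS of abc-iut-w5-d166's
`Cor312SettingMSharp` (p435453) — Θ-boxes `thetaBoxM t`, `q`-centre `qCentreM tq`, over abc-iut-w5-d166's presentation
`presAtM` of the genuine completions `K_{v̲}`, `v̲ ∈ V̲` ([IUTchI] Def. 3.1 (e)), weights the probability weights of `V_mod` —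
for Θ-ideles `t` REALISING the Θ-pilot divisor `P_Θ` of the pilot data `pilotData D` of the initial Θ-data over `F_mod` in
Dupuy–Hilado's normalisation (3.4), in abc-iut-w5-d033's shape `log ‖t_{Θ,i+1,v̲(x)}‖ = −P_{Θ,i+1}(v(x))·ln|κ(v(x))|/n_{v(x)}`
(`ht`; for the Θ-ideles `tOfIdeleData D r` READ OFF a genuine idele datum this is abc-iut-w5-d033's THEOREM `log_norm_tThetaM`):

* §1 `logvol_thetaRegion_settingPrVolM_sharp_non` — every `(n,m)`-Kummer image of the Θ-pilot object at `(i+1, u)` (the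
  sharp boxes do not depend on `m`: Dupuy–Hilado §4.10) has probability-weighted log-measure
  `−(1/[F_mod:ℚ])·Σ_{v | p_u} P_{Θ,i+1}(v)·log N(v)` (abc-iut-w5-d244's expectation identity `logvol_preimage_pi_PrM_of_last` —
  Dupuy–Hilado Thm. 3.10.1 (i) at one prime — on abc-iut-s2-p8's generic sharp regions); `0` at `∞`;
* §2 `finsum_logvol_thetaRegion_settingPrVolM_sharp = −deĝ(P_{Θ,i+1})` (`= −FinDivisor.ndeg F_mod ((pilotData D).thetaPilot i)`;
  Dupuy–Hilado Thm. 3.10.1 (ii) for the Θ-pilot, prime by prime, over `V(ℚ)`: abc-iut-w5-d166's `placeOfPrimeQ`);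
* §3 `processionNormalized_thetaRegion_settingPrVolM_sharp = −deĝ_lgp(P_Θ)` for EVERY assignment of lattice positions, and
  **`neg_ndegLgp_le_negLogTheta_settingPrVolM_sharp`**: `↑(−deĝ_lgp(P_Θ)) ≤ −|log(Θ)|` — the TRIVIAL direction at the genuine
  carriers (every Kummer image lies in the hull of the union of the possible images; log-volume monotone on admissible regions
  — abc-iut-c312-6's `logvol_thetaRegion_le_thetaLocal_of_mono` with `LogvolMono`/`ThetaRegionsAdm`/`ThetaFinite` from this seat's
  `bridgeHyps_settingPrVolM_sharp` / `thetaFinite_settingPrVolM_sharp` (p438888));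
* §4 the GENUINE instance `t := tOfIdeleData D r` (abc-iut-w5-d166, p438889; the datum's OWN Θ-ideles, no `ht` binder):
  **`neg_ndegLgp_le_negLogTheta_settingPrVolM_tOfIdeleData`** `: ↑(−deĝ_lgp((pilotData D).thetaPilot)) ≤ −|log(Θ)|`, i.e. (by
  `rfl`, `(volumeInputOf D r).X = pilotData D`) `↑(−deĝ_lgp((volumeInputOf D r).X.thetaPilot)) ≤ −|log(Θ)|`. Together with unit P6
  (`negLogTheta ≤ ↑(volumeInputOf D r).negLogTheta`, abc-iut-w5-d166 `negLogTheta_settingPrVolSharpM_le_genuine_of_orbitHull`, one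
  residual `hA`) and abc-iut-S2's `hullEstimateOf_ofInput` (`negLogThetaNonarch ≤ −deĝ_lgp + explicitDelta`), the typed `−|log(Θ)|`
  of the M-level setting of the datum's own ideles is PINNED in `[−deĝ_lgp(P_Θ), −deĝ_lgp(P_Θ) + explicitDelta + ((l+5)/4)·log π]`
  (`≤` with an explicit two-sided window; never `=`: the archimedean summand). [claim: Mochizuki2012, status: disputed] for the quoted
setting; [cite: DupuyHilado2025, §3.3, §3.4, §3.6, §3.9, Thm. 3.10.1, §4.10]; [cite: Mochizuki2012, IUTchIII Cor. 3.12 p. 173–174].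
HONEST FRAMING: numbers at one instantiation; nothing asserted or denied about Cor. 3.12; typed ≠ proved; instantiated ≠ endorsed. -/

noncomputable section

open Set Function NumberField IsDedekindDomain Bornology
open scoped Pointwise

namespace Summit.ABC.IUTFork.Thm311.Real

open Cor312 Cor312Vol Literature.IUT.LogThetaLattice Literature.IUT.LogVolume Literature.IUT.HodgeTheaters
  Literature.NumberTheory.NumberFields

variable {F K Fbar : Type} [Field F] [NumberField F] [Field K] [NumberField K] [Algebra F K]
  [Field Fbar] [Algebra F Fbar] [Algebra K Fbar] {E : WeierstrassCurve F} [E.IsElliptic] {l : ℕ}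
  {Pb : BadPlacePredicates K} (D : InitialThetaData F K Fbar E l Pb) {logvK : PadicLogsVal K}
  (hlog : LogvAnalyticVal logvK)

/-! ## §0. Two index facts on the finite places of `ℚ` -/

/-- A finite place of `ℚ` whose prime is `p` IS abc-iut-w5-d166's `placeOfPrimeQ p` (dependent-argument form of
`placeOfPrimeQ_ratChar`). [folklore] -/
theorem placeOfPrimeQ_eq_of_eq_ratChar (u : FinitePlace ℚ) {p : ℕ} (hp : p.Prime) (h : p = ratChar u) :
    placeOfPrimeQ p hp = u := by
  subst h
  exact placeOfPrimeQ_ratChar u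

/-- `placeOfPrimeQ` does not read its primality witness. [folklore] -/
theorem placeOfPrimeQ_congr {p q : ℕ} (hp : p.Prime) (hq : q.Prime) (h : p = q) :
    placeOfPrimeQ p hp = placeOfPrimeQ q hq := by
  subst h
  rfl

section Sharp

variable (M : Type) [Field M] [NumberField M]
  (archPk : ∀ (j : (thetaIndexOfInitial D).Label) (vQ : (thetaIndexOfInitial D).VQ),
    Set ((logShellsOfInitialDH D logvK).Packet j vQ))
  (archSub : ∀ (j : (thetaIndexOfInitial D).Label) (v : (thetaIndexOfInitial D).V),
    Set ((logShellsOfInitialDH D logvK).Packet j ((thetaIndexOfInitial D).over v)))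
  (Ψ : ℤ → ∀ v : (thetaIndexOfInitial D).V, v ∈ (thetaIndexOfInitial D).Vbad →
    Set ((logShellsOfInitialDH D logvK).StarPacket v))
  (act : ℤ → ∀ v : (thetaIndexOfInitial D).V, v ∈ (thetaIndexOfInitial D).Vbad →
    (logShellsOfInitialDH D logvK).StarPacket v → Module.End ℚ ((logShellsOfInitialDH D logvK).StarPacket v))
  (Mmod : ℤ → ∀ j : (thetaIndexOfInitial D).LabelStar, Set ((logShellsOfInitialDH D logvK).GlobalPacket j.1))
  (region : ℤ → ∀ j : (thetaIndexOfInitial D).LabelStar, FinDivisor M → ∀ vQ : (thetaIndexOfInitial D).VQ,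
    Set ((logShellsOfInitialDH D logvK).Packet j.1 vQ))
  (n : ℤ) {HT : Type} {LogLink : HT → HT → Type} {IsFull : ∀ {s t : HT}, LogLink s t → Prop}
  (lat : LGPGaussianLogThetaLattice LogLink IsFull)
  {Frd : Type} {IsoF : Frd → Frd → Type} {Ob : Frd → Type} {realify : Frd → Frd} {Strip : Type}
  {IsoS : Strip → Strip → Type} {Mv : ∀ v : (thetaIndexOfInitial D).V, v ∈ (thetaIndexOfInitial D).Vbad → Type}
  [∀ v h, Monoid (Mv v h)]
  (sig : GlobalLGPFrobenioidSignature (thetaIndexOfInitial D).lstar (thetaIndexOfInitial D).V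
    (· ∈ (thetaIndexOfInitial D).Vbad) Frd IsoF Ob realify Strip IsoS Mv)
  (split : SplittingMonoids Mv) {ObΔ : Type} {N : ∀ v : (thetaIndexOfInitial D).V, v ∈ (thetaIndexOfInitial D).Vbad → Type}
  [∀ v h, Monoid (N v h)] (qData : QPilotData ObΔ N)
  (t : ∀ (u : FinitePlace ℚ) (_ : Fin (thetaIndexOfInitial D).lstar) (x : (thetaIndexOfInitial D).Fibre (Val.non u)),
    kOfM D (ratChar u) u (natCast_ratChar_mem u) x)
  (tq : ∀ (u : FinitePlace ℚ) (x : (thetaIndexOfInitial D).Fibre (Val.non u)),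
    kOfM D (ratChar u) u (natCast_ratChar_mem u) x)
  (htq0 : ∀ u x, tq u x ≠ 0)
  (hfin : ∀ j : (thetaIndexOfInitial D).Label, (Function.support fun vQ =>
    ((situationPrVolM D hlog M archPk archSub Ψ act Mmod region).D n).logvol j vQ
      (factorMapM D hlog j vQ ⁻¹' hullSet (factorFieldM D hlog j vQ)
        ((fun _ : ObΔ => qCentreM D hlog tq) (qPilotObject qData) j vQ))).Finite)
  (ht0 : ∀ u i x, t u i x ≠ 0)
  /- the Θ-ideles REALISE `P_Θ` of the pilot data of `D` over `F_mod` in Dupuy–Hilado's normalisation (3.4) -/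
  (ht : ∀ (u : FinitePlace ℚ) (i : Fin (thetaIndexOfInitial D).lstar) (x : (thetaIndexOfInitial D).Fibre (Val.non u)),
    Real.log ‖t u i x‖ =
      -((ThetaData.pilotData D).thetaPilot i (placeModOfM D u x)) * logNorm (fieldOfModuli E) (placeModOfM D u x) /
        localDegree (fieldOfModuli E) (placeModOfM D u x))

/-! ## §1. The volume of every Kummer image of the Θ-pilot object, sharp boxes, probability weights of `V_mod` -/

/-- Every `(n,m)`-Kummer image of the Θ-pilot object at a finite place IS the preimage of the (constant-in-`m`) sharp box
`Π_{v⃗} ι_j(t_{Θ,j,v̲_j})·(R_I)^∼` (Dupuy–Hilado §4.10). [cite: DupuyHilado2025, §4.10] -/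
theorem thetaRegion_settingPrVolM_sharp_non (m : ℤ) (j : (thetaIndexOfInitial D).Label) (u : FinitePlace ℚ) :
    (settingPrVolM D hlog M archPk archSub Ψ act Mmod region n lat sig split qData (fun _ _ => thetaBoxM D hlog t)
      (fun _ => qCentreM D hlog tq) (qCentreM_ne_zero D hlog tq htq0) hfin).thetaRegion m j (Val.non u) =
      (presAtM D hlog u).comparison j ⁻¹' Set.pi univ ((presAtM D hlog u).sharpBox (t u) j) :=
  (presAtM D hlog u).factorMap_preimage_boxOf_sharpBox (t u) j

include ht0 ht in
/-- **The log-volume of every Kummer image at `(i+1, u)` is `−(1/[F_mod:ℚ])·Σ_{v | p_u} P_{Θ,i+1}(v)·log N(v)`** for Θ-ideles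
realising `P_Θ` (abc-iut-w5-d244's expectation identity `logvol_preimage_pi_PrM_of_last` with `c := −P_{Θ,i+1}` on abc-iut-s2-p8's
sharp regions, whose summand log-measures are `log ‖t_{Θ,i+1,v̲_{i+1}}‖`). [cite: DupuyHilado2025, §3.9, Thm. 3.10.1] -/
theorem logvol_thetaRegion_settingPrVolM_sharp_non (m : ℤ) (i : Fin (thetaIndexOfInitial D).lstar) (u : FinitePlace ℚ) :
    ((situationPrVolM D hlog M archPk archSub Ψ act Mmod region).D n).logvol (Setting.labelSucc i) (Val.non u)
      ((settingPrVolM D hlog M archPk archSub Ψ act Mmod region n lat sig split qData (fun _ _ => thetaBoxM D hlog t)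
        (fun _ => qCentreM D hlog tq) (qCentreM_ne_zero D hlog tq htq0) hfin).thetaRegion m (Setting.labelSucc i) (Val.non u)) =
      (∑ v ∈ placesOver (fieldOfModuli E) (ratChar u),
        -((ThetaData.pilotData D).thetaPilot i v) * logNorm (fieldOfModuli E) v) / Module.finrank ℚ (fieldOfModuli E) := by
  rw [thetaRegion_settingPrVolM_sharp_non D hlog M archPk archSub Ψ act Mmod region n lat sig split qData t tq htq0 hfin m _ u]
  refine ((realizes_situationPrVolM D hlog M archPk archSub Ψ act Mmod region n).logvol_eq _ (Val.non u) _).trans ?_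
  exact logvol_preimage_pi_PrM_of_last D hlog u (Setting.labelSucc i) ((presAtM D hlog u).sharpBox (t u) (Setting.labelSucc i))
    (fun e => (presAtM D hlog u).packetAdm_sharpBox (t u) (ht0 u) _ e)
    (fun v => -((ThetaData.pilotData D).thetaPilot i v)) fun e => by
      rw [(presAtM D hlog u).packetLogμ_sharpBox_labelSucc (t u) (ht0 u) i e]
      exact ht u i _

/-- At the archimedean place every Kummer image has log-volume `0` (trivial archimedean container). [folklore] -/
theorem logvol_thetaRegion_settingPrVolM_sharp_arc (m : ℤ) (j : (thetaIndexOfInitial D).Label) (w : InfinitePlace ℚ) :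
    ((situationPrVolM D hlog M archPk archSub Ψ act Mmod region).D n).logvol j (Val.arc w)
      ((settingPrVolM D hlog M archPk archSub Ψ act Mmod region n lat sig split qData (fun _ _ => thetaBoxM D hlog t)
        (fun _ => qCentreM D hlog tq) (qCentreM_ne_zero D hlog tq htq0) hfin).thetaRegion m j (Val.arc w)) = 0 :=
  logvol_summandPiecesPrM_arc D hlog j w _

/-! ## §2. The global volume of every Kummer image is `−deĝ(P_{Θ,j})` -/

include ht0 ht in
open scoped Classical in
/-- The local volumes of the Kummer images vanish off the places of `ℚ` under the support of `P_{Θ,i+1}` (`⊆ S`).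
[claim: Mochizuki2012, status: disputed] -/
theorem support_logvol_thetaRegion_settingPrVolM_sharp_subset (m : ℤ) (i : Fin (thetaIndexOfInitial D).lstar) :
    (Function.support fun vQ : (thetaIndexOfInitial D).VQ =>
        ((situationPrVolM D hlog M archPk archSub Ψ act Mmod region).D n).logvol (Setting.labelSucc i) vQ
          ((settingPrVolM D hlog M archPk archSub Ψ act Mmod region n lat sig split qData (fun _ _ => thetaBoxM D hlog t)
            (fun _ => qCentreM D hlog tq) (qCentreM_ne_zero D hlog tq htq0) hfin).thetaRegion m (Setting.labelSucc i) vQ)) ⊆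
      ((((ThetaData.pilotData D).thetaPilot i).support.image fun v =>
        (Val.non (placeOfPrimeQ (residueChar (fieldOfModuli E) v) (residueChar_prime (fieldOfModuli E) v)) :
          (thetaIndexOfInitial D).VQ) : Finset (thetaIndexOfInitial D).VQ) : Set (thetaIndexOfInitial D).VQ) := by
  intro vQ hvQ
  rw [Function.mem_support] at hvQ
  rcases vQ with w | u
  · exact absurd (logvol_thetaRegion_settingPrVolM_sharp_arc D hlog M archPk archSub Ψ act Mmod region n lat sig split qData t
      tq htq0 hfin m _ w) hvQ
  · have hvQ' := hvQ
    rw [show (Sum.inr u : (thetaIndexOfInitial D).VQ) = Val.non u from rfl,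
      logvol_thetaRegion_settingPrVolM_sharp_non D hlog M archPk archSub Ψ act Mmod region n lat sig split qData t tq htq0 hfin
        ht0 ht m i u] at hvQ'
    obtain ⟨v, hv, hJv⟩ : ∃ v ∈ placesOver (fieldOfModuli E) (ratChar u),
        -((ThetaData.pilotData D).thetaPilot i v) * logNorm (fieldOfModuli E) v ≠ 0 := by
      by_contra hcon
      simp only [not_exists, not_and, not_not] at hcon
      exact hvQ' (by rw [Finset.sum_eq_zero hcon, zero_div])
    rw [Finset.coe_image, Set.mem_image]
    refine ⟨v, Finset.mem_coe.mpr (Finsupp.mem_support_iff.mpr fun h0 => hJv (by simp [h0])), ?_⟩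
    show Val.non _ = Val.non u
    exact congrArg Val.non (placeOfPrimeQ_eq_of_eq_ratChar u _ ((mem_placesOver_iff_residueChar v).mp hv))

include ht0 ht in
/-- The local volumes of the Kummer images are finitely supported over `V(ℚ)`. [claim: Mochizuki2012, status: disputed] -/
theorem finite_support_logvol_thetaRegion_settingPrVolM_sharp (m : ℤ) (i : Fin (thetaIndexOfInitial D).lstar) :
    (Function.support fun vQ : (thetaIndexOfInitial D).VQ =>
        ((situationPrVolM D hlog M archPk archSub Ψ act Mmod region).D n).logvol (Setting.labelSucc i) vQ
          ((settingPrVolM D hlog M archPk archSub Ψ act Mmod region n lat sig split qData (fun _ _ => thetaBoxM D hlog t)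
            (fun _ => qCentreM D hlog tq) (qCentreM_ne_zero D hlog tq htq0) hfin).thetaRegion m (Setting.labelSucc i)
            vQ)).Finite := by
  classical
  exact (Finset.finite_toSet _).subset (support_logvol_thetaRegion_settingPrVolM_sharp_subset D hlog M archPk archSub Ψ act
    Mmod region n lat sig split qData t tq htq0 hfin ht0 ht m i)

include ht0 ht in
open scoped Classical in
/-- **The global volume of every Kummer image of the Θ-pilot object at the label `j = i+1` is `−deĝ(P_{Θ,j})`**
(`= −FinDivisor.ndeg F_mod ((pilotData D).thetaPilot i)`; Dupuy–Hilado Thm. 3.10.1 (ii) for the Θ-pilot over the genuine carriers,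
prime by prime). [cite: DupuyHilado2025, Thm. 3.10.1] -/
theorem finsum_logvol_thetaRegion_settingPrVolM_sharp (m : ℤ) (i : Fin (thetaIndexOfInitial D).lstar) :
    ∑ᶠ vQ : (thetaIndexOfInitial D).VQ,
        ((situationPrVolM D hlog M archPk archSub Ψ act Mmod region).D n).logvol (Setting.labelSucc i) vQ
          ((settingPrVolM D hlog M archPk archSub Ψ act Mmod region n lat sig split qData (fun _ _ => thetaBoxM D hlog t)
            (fun _ => qCentreM D hlog tq) (qCentreM_ne_zero D hlog tq htq0) hfin).thetaRegion m (Setting.labelSucc i) vQ) =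
      -FinDivisor.ndeg (fieldOfModuli E) ((ThetaData.pilotData D).thetaPilot i) := by
  -- notation: the prime-place map on the places of `F_mod`
  set g : HeightOneSpectrum (𝓞 (fieldOfModuli E)) → (thetaIndexOfInitial D).VQ := fun v =>
    Val.non (placeOfPrimeQ (residueChar (fieldOfModuli E) v) (residueChar_prime (fieldOfModuli E) v)) with hg
  have hgg : ∀ v v₀ : HeightOneSpectrum (𝓞 (fieldOfModuli E)),
      g v = g v₀ ↔ residueChar (fieldOfModuli E) v = residueChar (fieldOfModuli E) v₀ := by
    intro v v₀
    constructor
    · intro h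
      have h1 : placeOfPrimeQ (residueChar (fieldOfModuli E) v) (residueChar_prime (fieldOfModuli E) v) =
          placeOfPrimeQ (residueChar (fieldOfModuli E) v₀) (residueChar_prime (fieldOfModuli E) v₀) := Sum.inr_injective h
      rw [← ratChar_placeOfPrimeQ (residueChar (fieldOfModuli E) v) (residueChar_prime (fieldOfModuli E) v), h1,
        ratChar_placeOfPrimeQ]
    · intro h
      exact congrArg Val.non (placeOfPrimeQ_congr _ _ h)
  rw [finsum_eq_sum_of_support_subset _ (support_logvol_thetaRegion_settingPrVolM_sharp_subset D hlog M archPk archSub Ψ act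
    Mmod region n lat sig split qData t tq htq0 hfin ht0 ht m i)]
  have hterm : ∀ vQ ∈ ((ThetaData.pilotData D).thetaPilot i).support.image g,
      ((situationPrVolM D hlog M archPk archSub Ψ act Mmod region).D n).logvol (Setting.labelSucc i) vQ
          ((settingPrVolM D hlog M archPk archSub Ψ act Mmod region n lat sig split qData (fun _ _ => thetaBoxM D hlog t)
            (fun _ => qCentreM D hlog tq) (qCentreM_ne_zero D hlog tq htq0) hfin).thetaRegion m (Setting.labelSucc i) vQ) =
        (∑ v ∈ ((ThetaData.pilotData D).thetaPilot i).support with g v = vQ,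
            -((ThetaData.pilotData D).thetaPilot i v) * logNorm (fieldOfModuli E) v) / Module.finrank ℚ (fieldOfModuli E) := by
    intro vQ hvQ
    obtain ⟨v₀, -, rfl⟩ := Finset.mem_image.mp hvQ
    haveI : Fact (residueChar (fieldOfModuli E) v₀).Prime := ⟨residueChar_prime (fieldOfModuli E) v₀⟩
    have h := logvol_thetaRegion_settingPrVolM_sharp_non D hlog M archPk archSub Ψ act Mmod region n lat sig split qData t tq
      htq0 hfin ht0 ht m i (placeOfPrimeQ (residueChar (fieldOfModuli E) v₀) (residueChar_prime (fieldOfModuli E) v₀))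
    rw [ratChar_placeOfPrimeQ] at h
    rw [show g v₀ = Val.non (placeOfPrimeQ (residueChar (fieldOfModuli E) v₀) (residueChar_prime (fieldOfModuli E) v₀))
      from rfl, h]
    congr 1
    symm
    apply Finset.sum_subset
    · intro v hv
      rw [Finset.mem_filter] at hv
      exact (mem_placesOver_iff_residueChar v).mpr ((hgg v v₀).mp hv.2)
    · intro v hv hv'
      rw [Finset.mem_filter, not_and'] at hv'
      have hres : g v = g v₀ := (hgg v v₀).mpr ((mem_placesOver_iff_residueChar v).mp hv)
      have hJ : (ThetaData.pilotData D).thetaPilot i v = 0 := Finsupp.notMem_support_iff.mp (hv' hres)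
      simp [hJ]
  rw [Finset.sum_congr rfl hterm, ← Finset.sum_div, Finset.sum_fiberwise_of_maps_to (g := g)
    (fun v hv => Finset.mem_image_of_mem g hv), FinDivisor.ndeg_apply, FinDivisor.deg_apply, Finsupp.sum, ← neg_div,
    ← Finset.sum_neg_distrib]
  refine congrArg (· / _) (Finset.sum_congr rfl fun v _ => ?_)
  ring

/-! ## §3. `−deĝ_lgp(P_Θ) ≤ −|log(Θ)|` at the sharp binders -/

/-- `−deĝ_lgp(P_Θ)` is the procession-normalized family of the `−deĝ(P_{Θ,j})` for the pilot data of `D` over `F_mod`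
(abc-iut-c312-7's `processionNormalized_neg_ndeg_thetaPilot`). [cite: DupuyHilado2025, Def. 3.1.1] -/
theorem processionNormalized_neg_ndeg_thetaPilot_pilotData :
    processionNormalized (fun i : Fin (thetaIndexOfInitial D).lstar =>
        -FinDivisor.ndeg (fieldOfModuli E) ((ThetaData.pilotData D).thetaPilot i)) =
      -LgpDivisor.ndegLgp (ThetaData.pilotData D).thetaPilot :=
  processionNormalized_neg_ndeg_thetaPilot (ThetaData.pilotData D)

include ht0 ht in
/-- **For EVERY assignment of lattice positions, the procession-normalized global volume of the chosen Kummer images of the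
Θ-pilot object at the sharp binders is `−deĝ_lgp(P_Θ)`** (the boxes are constant in `m`). [cite: DupuyHilado2025, Thm. 3.10.1] -/
theorem processionNormalized_thetaRegion_settingPrVolM_sharp
    (m : Fin (thetaIndexOfInitial D).lstar → (thetaIndexOfInitial D).VQ → ℤ) :
    processionNormalized (fun i : Fin (thetaIndexOfInitial D).lstar => ∑ᶠ vQ : (thetaIndexOfInitial D).VQ,
        ((situationPrVolM D hlog M archPk archSub Ψ act Mmod region).D n).logvol (Setting.labelSucc i) vQ
          ((settingPrVolM D hlog M archPk archSub Ψ act Mmod region n lat sig split qData (fun _ _ => thetaBoxM D hlog t)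
            (fun _ => qCentreM D hlog tq) (qCentreM_ne_zero D hlog tq htq0) hfin).thetaRegion (m i vQ) (Setting.labelSucc i) vQ)) =
      -LgpDivisor.ndegLgp (ThetaData.pilotData D).thetaPilot := by
  rw [← processionNormalized_neg_ndeg_thetaPilot_pilotData D]
  congr 1
  funext i
  -- the `v_ℚ`-sum does not depend on the positions `m i v_ℚ`: compare with the constant position `0`
  have hpt : ∀ vQ, ((situationPrVolM D hlog M archPk archSub Ψ act Mmod region).D n).logvol (Setting.labelSucc i) vQ
        ((settingPrVolM D hlog M archPk archSub Ψ act Mmod region n lat sig split qData (fun _ _ => thetaBoxM D hlog t)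
          (fun _ => qCentreM D hlog tq) (qCentreM_ne_zero D hlog tq htq0) hfin).thetaRegion (m i vQ) (Setting.labelSucc i) vQ) =
      ((situationPrVolM D hlog M archPk archSub Ψ act Mmod region).D n).logvol (Setting.labelSucc i) vQ
        ((settingPrVolM D hlog M archPk archSub Ψ act Mmod region n lat sig split qData (fun _ _ => thetaBoxM D hlog t)
          (fun _ => qCentreM D hlog tq) (qCentreM_ne_zero D hlog tq htq0) hfin).thetaRegion 0 (Setting.labelSucc i) vQ) :=
    fun _ => rfl
  simp_rw [hpt]
  exact finsum_logvol_thetaRegion_settingPrVolM_sharp D hlog M archPk archSub Ψ act Mmod region n lat sig split qData t tq htq0 hfin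
    ht0 ht 0 i

include ht0 in
/-- **`ThetaRegionsAdm` at the sharp binders**: every `(n,m)`-Kummer image of the Θ-pilot object is an admissible region of the
M-level probability-weighted container at every `(j ∈ 𝔽_l^⋇, v_ℚ)` (a direct product of nondegenerate translates of `(R_I)^∼` at a
finite place; the whole packet in the trivial archimedean container). [claim: Mochizuki2012, status: disputed] -/
theorem thetaRegionsAdm_settingPrVolM_sharp :
    ThetaRegionsAdm (settingPrVolM D hlog M archPk archSub Ψ act Mmod region n lat sig split qData (fun _ _ => thetaBoxM D hlog t)
      (fun _ => qCentreM D hlog tq) (qCentreM_ne_zero D hlog tq htq0) hfin) := by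
  intro m i vQ
  rcases vQ with w | u
  · refine (LocalPieces.adm_trivial_iff (logShellsOfInitialDH D logvK) (Val.arc w) _ _).2 ⟨0, ?_⟩
    exact Set.mem_univ _
  · exact (presAtM D hlog u).adm_preimage_boxOf ((presAtM D hlog u).packetAdm_sharpBox (t u) (ht0 u) (Setting.labelSucc i))

variable
  /- the Θ-ideles are units off a finite set of rational places -/
  (Sθ : Finset (FinitePlace ℚ))
  (ht1 : ∀ (u : FinitePlace ℚ) (i : Fin (thetaIndexOfInitial D).lstar) (x : (thetaIndexOfInitial D).Fibre (Val.non u)),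
    u ∉ Sθ → ‖t u i x‖ = 1)

include ht0 ht Sθ ht1 in
/-- **`−deĝ_lgp(P_Θ) ≤ −|log(Θ)|` at the M-LEVEL summand-route sharp setting** — the TRIVIAL direction at the genuine carriers:
the holomorphic hull of the union of the possible images contains every single Kummer image and the probability-weighted
log-volume is monotone on admissible regions (abc-iut-c312-6 `logvol_thetaRegion_le_thetaLocal_of_mono`; `LogvolMono`,
`ThetaFinite` by this seat's `bridgeHyps_settingPrVolM_sharp` / `thetaFinite_settingPrVolM_sharp`, `ThetaRegionsAdm` above).
The M-level twin of abc-iut-c312-7's `neg_ndegLgp_le_negLogTheta_settingPrVolSharp`. [claim: Mochizuki2012, status: disputed] -/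
theorem neg_ndegLgp_le_negLogTheta_settingPrVolM_sharp :
    (((-LgpDivisor.ndegLgp (ThetaData.pilotData D).thetaPilot : ℝ)) : WithTop ℝ) ≤
      (settingPrVolM D hlog M archPk archSub Ψ act Mmod region n lat sig split qData (fun _ _ => thetaBoxM D hlog t)
        (fun _ => qCentreM D hlog tq) (qCentreM_ne_zero D hlog tq htq0) hfin).negLogTheta := by
  have hfinΘ := thetaFinite_settingPrVolM_sharp D hlog M archPk archSub Ψ act Mmod region n lat sig split qData t tq htq0 hfin
    ht0 Sθ ht1
  have hadm := thetaRegionsAdm_settingPrVolM_sharp D hlog M archPk archSub Ψ act Mmod region n lat sig split qData t tq htq0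
    hfin ht0
  have hmono := (bridgeHyps_settingPrVolM_sharp D hlog M archPk archSub Ψ act Mmod region n lat sig split qData t tq htq0 hfin
    ht0 Sθ ht1).mono
  unfold Setting.negLogTheta
  rw [if_pos hfinΘ, WithTop.coe_le_coe,
    ← processionNormalized_thetaRegion_settingPrVolM_sharp D hlog M archPk archSub Ψ act Mmod region n lat sig split qData t tq
      htq0 hfin ht0 ht (fun _ _ => 0)]
  refine processionNormalized_mono fun i => ?_
  exact finsum_le_finsum'
    (finite_support_logvol_thetaRegion_settingPrVolM_sharp D hlog M archPk archSub Ψ act Mmod region n lat sig split qData t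
      tq htq0 hfin ht0 ht 0 i)
    (hfinΘ.2 i) fun vQ => logvol_thetaRegion_le_thetaLocal_of_mono hmono hfinΘ hadm 0 i vQ

end Sharp

/-! ## §4. The GENUINE instance: the datum's own Θ-ideles `tOfIdeleData D r` -/

section Genuine

variable (r : ThetaData.IdeleData D) (M : Type) [Field M] [NumberField M]
  (archPk : ∀ (j : (thetaIndexOfInitial D).Label) (vQ : (thetaIndexOfInitial D).VQ),
    Set ((logShellsOfInitialDH D logvK).Packet j vQ))
  (archSub : ∀ (j : (thetaIndexOfInitial D).Label) (v : (thetaIndexOfInitial D).V),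
    Set ((logShellsOfInitialDH D logvK).Packet j ((thetaIndexOfInitial D).over v)))
  (Ψ : ℤ → ∀ v : (thetaIndexOfInitial D).V, v ∈ (thetaIndexOfInitial D).Vbad →
    Set ((logShellsOfInitialDH D logvK).StarPacket v))
  (act : ℤ → ∀ v : (thetaIndexOfInitial D).V, v ∈ (thetaIndexOfInitial D).Vbad →
    (logShellsOfInitialDH D logvK).StarPacket v → Module.End ℚ ((logShellsOfInitialDH D logvK).StarPacket v))
  (Mmod : ℤ → ∀ j : (thetaIndexOfInitial D).LabelStar, Set ((logShellsOfInitialDH D logvK).GlobalPacket j.1))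
  (region : ℤ → ∀ j : (thetaIndexOfInitial D).LabelStar, FinDivisor M → ∀ vQ : (thetaIndexOfInitial D).VQ,
    Set ((logShellsOfInitialDH D logvK).Packet j.1 vQ))
  (n : ℤ) {HT : Type} {LogLink : HT → HT → Type} {IsFull : ∀ {s t : HT}, LogLink s t → Prop}
  (lat : LGPGaussianLogThetaLattice LogLink IsFull)
  {Frd : Type} {IsoF : Frd → Frd → Type} {Ob : Frd → Type} {realify : Frd → Frd} {Strip : Type}
  {IsoS : Strip → Strip → Type} {Mv : ∀ v : (thetaIndexOfInitial D).V, v ∈ (thetaIndexOfInitial D).Vbad → Type}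
  [∀ v h, Monoid (Mv v h)]
  (sig : GlobalLGPFrobenioidSignature (thetaIndexOfInitial D).lstar (thetaIndexOfInitial D).V
    (· ∈ (thetaIndexOfInitial D).Vbad) Frd IsoF Ob realify Strip IsoS Mv)
  (split : SplittingMonoids Mv) {ObΔ : Type} {N : ∀ v : (thetaIndexOfInitial D).V, v ∈ (thetaIndexOfInitial D).Vbad → Type}
  [∀ v h, Monoid (N v h)] (qData : QPilotData ObΔ N)
  (tq : ∀ (u : FinitePlace ℚ) (x : (thetaIndexOfInitial D).Fibre (Val.non u)),
    kOfM D (ratChar u) u (natCast_ratChar_mem u) x)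
  (htq0 : ∀ u x, tq u x ≠ 0)
  (hfin : ∀ j : (thetaIndexOfInitial D).Label, (Function.support fun vQ =>
    ((situationPrVolM D hlog M archPk archSub Ψ act Mmod region).D n).logvol j vQ
      (factorMapM D hlog j vQ ⁻¹' hullSet (factorFieldM D hlog j vQ)
        ((fun _ : ObΔ => qCentreM D hlog tq) (qPilotObject qData) j vQ))).Finite)

open scoped Classical in
/-- **Off the rational places under the bad places `S = 𝕍^bad_mod` the read-off Θ-ideles are units** — `ht1` for
`tOfIdeleData D r` with the finite set `{placeOfPrimeQ (char v) : v ∈ S}` (abc-iut-w5-d166's `norm_tOfIdeleData_eq_one_of_not_mem`).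
[cite: DupuyHilado2025, §3.3, §3.9] -/
theorem norm_tOfIdeleData_eq_one_of_not_mem_image (u : FinitePlace ℚ) (i : Fin (thetaIndexOfInitial D).lstar)
    (x : (thetaIndexOfInitial D).Fibre (Val.non u))
    (hu : u ∉ (ThetaData.pilotData D).S.image fun v =>
      placeOfPrimeQ (residueChar (fieldOfModuli E) v) (residueChar_prime (fieldOfModuli E) v)) :
    ‖tOfIdeleData D r u i x‖ = 1 := by
  refine norm_tOfIdeleData_eq_one_of_not_mem D r u (fun hmem => hu ?_) i x
  obtain ⟨v, hv, hvu⟩ := Finset.mem_image.mp hmem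
  exact Finset.mem_image.mpr ⟨v, hv, placeOfPrimeQ_eq_of_eq_ratChar u _ hvu⟩

/-- **`−deĝ_lgp(P_Θ) ≤ −|log(Θ)|` for the M-LEVEL summand-route setting of the datum's OWN Θ-ideles** (`t := tOfIdeleData D r`:
`ht0`, the realisation `ht` and `ht1` are abc-iut-w5-d033's THEOREMS `tThetaM_ne_zero` / `log_norm_tThetaM` /
`norm_tThetaM_eq_one_of_not_mem`). Since `(volumeInputOf D r).X = pilotData D` (by `rfl`), the left-hand side is abc-iut-S2's
`−deĝ_lgp((volumeInputOf D r).X.thetaPilot)`, the quantity its `free_inequality_input` / `hullEstimateOf_ofInput` frame.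
[claim: Mochizuki2012, status: disputed] -/
theorem neg_ndegLgp_le_negLogTheta_settingPrVolM_tOfIdeleData :
    (((-LgpDivisor.ndegLgp (ThetaData.volumeInputOf D r).X.thetaPilot : ℝ)) : WithTop ℝ) ≤
      (settingPrVolM D hlog M archPk archSub Ψ act Mmod region n lat sig split qData (fun _ _ => thetaBoxM D hlog (tOfIdeleData D r))
        (fun _ => qCentreM D hlog tq) (qCentreM_ne_zero D hlog tq htq0) hfin).negLogTheta := by
  classical
  exact neg_ndegLgp_le_negLogTheta_settingPrVolM_sharp D hlog M archPk archSub Ψ act Mmod region n lat sig split qData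
    (tOfIdeleData D r) tq htq0 hfin (tOfIdeleData_ne_zero D r)
    (fun u i x => log_norm_tThetaM D (ratChar u) u (natCast_ratChar_mem u) r i x)
    ((ThetaData.pilotData D).S.image fun v =>
      placeOfPrimeQ (residueChar (fieldOfModuli E) v) (residueChar_prime (fieldOfModuli E) v))
    (fun u i x hu => norm_tOfIdeleData_eq_one_of_not_mem_image D r u i x hu)

end Genuine

end Summit.ABC.IUTFork.Thm311.Real

end
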